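import Summits.Ventures.YMGap.BEDoor.StripFormat

/-!
# BEDoor / Receivers — §7 hypothesis-free receivers, §8a–b smoothing that keeps the Dobrushin moduli
# (module 08/11 of the Bakry–Émery door, LIFT edition v8.3 = parts `Receivers` (v8.2 module 12); cell `ym-beyond`, seat P4)

HONEST FRAMING (cell `ym-beyond`, seat P4 «Hessian-currency receiver», lens Y2; HUMAN RULINGS D-0035 / D-0037; memo `HOME/ROUTE-P4Y2.md` v8.1 +
g10 addendum, spec `HOME/ROUTE-P4Y2-LIFT-SPEC-v83.md`; LIFT edition v8.3 = the v8.2 module bodies of `HOME/ROUTE-P4Y2-Sketch.lean` v8.1, byte-identical and in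
order, re-packed into 11 ≤ 400-line modules (fewer olean round-trips; director-ym line №2 (B)); the g10 appendix `OpenStrip` is a separate, UNQUEUED HOME file (line №3 (D))).  FINITE-LATTICE
statements at STRONG effective coupling: a RECEIVER («door») in HESSIAN (Bakry–Émery) currency for renormalisation-group output, typed over the
tree's generic clustering chain `Thresholds/SharpClustering*` + `Thresholds/LatticeBakryEmery*`, complementary to the Dobrushin-currency door
`YM4Door/*` (LITERALLY the same INPUT predicate `QuasiLocalGaugePerturbation.HasAnalyticNormLE … stripDomain`, the same OUTPUT predicate
`RobustBall.ClustersWith`; no residual hypothesis: Osgood regularity is the tree's `Literature.Analysis.Complex.SCV.contDiffOn_infty`,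
part `Osgood` of module `AnalyticStrip`).  Nothing here is a statement about `β → ∞`, the continuum limit or the Clay problem; NO effective action is asserted to be at
the door (that INPUT is not in print for `d = 4`); the verdict «the two windows do not meet» is unchanged in this currency.
WHAT THIS IS NOT (ladder rung R2d; director-ym line №2 (B)): every door of this LIFT is an entry on the STRONG-COUPLING BANK of THE NUMBER —
finite-lattice exponential clustering at SMALL `|β|` and small strip norm `η` of the perturbation (`SU(2)`, `d = 4`: `16.2|β| + 4.4η < 1`, module `SU2`,
conclusion literally `RobustBall.ClustersWith`) — NOT clustering at weak coupling, NOT a statement at large `β`, NOT the mass gap.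
No conjecture name, no `sorry`, no axiom beyond the standard three; every theorem is bookkeeping over the tree. [folklore]
References: H. Shen, R. Zhu, X. Zhu, CMP 400 (2023) 805 (arXiv:2204.12737) Thm 1.2, Cor. 4.4/4.11; D. Bakry, M. Émery, LNM 1123 (1985);
T. Bałaban, CMP 109 (1987) 249, (1.18)–(1.22) (analyticity format); L. Hörmander, An Introduction to Complex Analysis in Several Variables
(1973) Thm 2.2.1/2.2.6 (Osgood); E. J. McShane, Bull. AMS 40 (1934) 837 (Lipschitz extension).

THIS MODULE, part `Receivers` (§7 hypothesis-free receivers, §8a–b smoothing that keeps the Dobrushin moduli): `beDoorQL_gibbsCov_le_of_smooth`,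
`…_of_strip'`, `…_of_format'`, `perturbedMeasure_cov_le_of_format'` (every receiver WITHOUT the `C2PolyApprox` hypothesis); `SumLip`, ★
`exists_contDiff_sumLip_approx` (abstract finite-dimensional `ι → V`: `ContDiffBump` convolution preserving the moduli), `mcShane`, `sumLip_mcShane`,
`mcShane_emb`, ★ `exists_contDiff_linkLipschitz_approx` (bounded + `IsLipBound suFrobDist f δ` ⇒ uniform limit on `SU(N)^ι` of smooth ambient `u` with
`LinkLipschitz u δ`).
-/

noncomputable section

open scoped Matrix ComplexConjugate BigOperators Matrix.Norms.Frobenius ContDiff Topology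
open Matrix Complex Finset MeasureTheory Filter
open Literature.MathematicalPhysics.QuantumFieldTheory
open Literature.MathematicalPhysics.QuantumFieldTheory.SUNBakryEmery (SUN FrameIdx frame)

namespace Summit.Ventures.YMGap.BEDoor

open Summit.Ventures.YMGap Summit.Ventures.YMGap.LatticeBakryEmery Summit.Ventures.YMGap.SharpClustering
open Summit.Ventures.YMGap.HessianSharp

universe u

/-! ## §7 ★★★ THE RECEIVER WITH NO RECEIVER-SIDE HYPOTHESIS LEFT (v6): format data + the door ⇒ clustering
With D1 proved (§4e, `c2PolyApprox_of_contDiff`) the hypothesis `C2PolyApprox` disappears from every receiver theorem: the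
quasi-local door for smooth remainders (§4d), the end-to-end strip / format theorems (§5c) and the member-measure theorem (§6) now
take ONLY Bałaban-format data (`E i` smooth with `StripBoundOn (E i) (X i) (M i) r`, `D`-oscillations `δ i`, the two loads `η`,
`Θ`) plus the door inequality `hK`.  What remains between this receiver and a Clay-relevant statement is NOT on the receiver side:
it is the INPUT (a last-scale effective action in this format at an effective coupling inside the door — §3: the certified numbers
say the door `β_W,eff < (1 − Λ_R)/8` and Bałaban's small-field exit do not meet) — recorded, not claimed. -/

section Unconditional

variable {d N : ℕ} {L : ℕ} [NeZero L]

open scoped ProbabilityTheory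
open ProbabilityTheory
open Literature.MathematicalPhysics.QuantumLattice (fundamentalRep continuous_fundamentalRep)

/-- ★★★ **The quasi-local door for an arbitrary SMOOTH remainder** — `beDoorQL_gibbsCov_le_of_approx` with the approximability
hypothesis discharged by D1 (`c2PolyApprox_of_contDiff`). [folklore assembly] [folklore] -/
theorem beDoorQL_gibbsCov_le_of_smooth {Λ₀ : ℝ} (hH : WilsonHessianBound d N Λ₀) (hN : N ≠ 0) (β : ℝ) (hL : 1 < L)
    {R : Cfg (Edge d L) N → ℝ} (hRc : ContDiff ℝ ∞ R)
    {ΛR : ℝ} (hRH : HessBound R ΛR) {hR : Edge d L → Edge d L → ℝ} (hRO : OffDiagHessBound R hR)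
    (hR0 : ∀ e e', 0 ≤ hR e e') (hRsymm : ∀ e e', hR e e' = hR e' e)
    (D : Edge d L → ℕ) (hD : ∀ e e', e' ∈ linkNbrT e → D e ≤ D e' + 1) {κ ΘR : ℝ} (hκ : 0 ≤ κ)
    (hΘR : ∀ e, ∑ e', hR e e' * (Real.exp (κ * |(D e : ℝ) - D e'|) - 1) ≤ ΘR)
    (hK : 0 < (N : ℝ) / 2 - ((N : ℝ) * |β| * Λ₀ + ΛR) -
      (max (6 * ((d : ℝ) - 1) * N * |β|) 0 * (Real.exp κ - 1) + ΘR))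
    {u v : Cfg (Edge d L) N → ℝ} (hu : ContDiff ℝ ∞ u) (hv : ContDiff ℝ ∞ v)
    {δu δv : Edge d L → ℝ} (hδu : ∀ e, 0 ≤ δu e) (hδv : ∀ e, 0 ≤ δv e)
    (hLu : LinkLipschitz u δu) (hLv : LinkLipschitz v δv)
    (hDv : ∀ e, δv e ≠ 0 → D e = 0) {m : ℕ} (hDu : ∀ e, δu e ≠ 0 → m ≤ D e) :
    |gibbsCov (wilsonPot d N L β + R) u v| ≤
      Real.exp (-κ * m) * (∑ e, δu e) * (∑ e, δv e) /
        ((N : ℝ) / 2 - ((N : ℝ) * |β| * Λ₀ + ΛR) - (max (6 * ((d : ℝ) - 1) * N * |β|) 0 * (Real.exp κ - 1) + ΘR)) :=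
  beDoorQL_gibbsCov_le_of_approx hH hN β hL hRc (c2PolyApprox_of_contDiff hRc) hRH hRO hR0 hRsymm D hD hκ hΘR hK hu hv
    hδu hδv hLu hLv hDv hDu

/-- ★★★ **END TO END ON THE TORUS FROM STRIP DATA ALONE** — `beDoorQL_gibbsCov_le_of_strip` without `C2PolyApprox`. [folklore assembly] [folklore] -/
theorem beDoorQL_gibbsCov_le_of_strip' {Λ₀ : ℝ} (hH : WilsonHessianBound d N Λ₀) (hN : N ≠ 0) (β : ℝ) (hL : 1 < L)
    {K : Type*} (s : Finset K) {E : K → Cfg (Edge d L) N → ℝ} (hE : ∀ i, ContDiff ℝ ∞ (E i))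
    {X : K → Finset (Edge d L)} {M : K → ℝ} {r : ℝ} (hr : 0 < r) (hM : ∀ i ∈ s, 0 ≤ M i)
    (hSB : ∀ i ∈ s, StripBoundOn (E i) (X i) (M i) r)
    {η : ℝ} (hη : ∀ e, hessLoad s X (fun i => 2 * M i / r ^ 2) e ≤ η)
    (D : Edge d L → ℕ) (hD : ∀ e e', e' ∈ linkNbrT e → D e ≤ D e' + 1) {κ Θ : ℝ} (hκ : 0 ≤ κ)
    (hΘ : ∀ e, ∑ e', stripProfile s X M r e e' * (Real.exp (κ * |(D e : ℝ) - D e'|) - 1) ≤ Θ)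
    (hK : 0 < (N : ℝ) / 2 - ((N : ℝ) * |β| * Λ₀ + η) -
      (max (6 * ((d : ℝ) - 1) * N * |β|) 0 * (Real.exp κ - 1) + Θ))
    {u v : Cfg (Edge d L) N → ℝ} (hu : ContDiff ℝ ∞ u) (hv : ContDiff ℝ ∞ v)
    {δu δv : Edge d L → ℝ} (hδu : ∀ e, 0 ≤ δu e) (hδv : ∀ e, 0 ≤ δv e)
    (hLu : LinkLipschitz u δu) (hLv : LinkLipschitz v δv)
    (hDv : ∀ e, δv e ≠ 0 → D e = 0) {m : ℕ} (hDu : ∀ e, δu e ≠ 0 → m ≤ D e) :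
    |gibbsCov (wilsonPot d N L β + ∑ i ∈ s, E i) u v| ≤
      Real.exp (-κ * m) * (∑ e, δu e) * (∑ e, δv e) /
        ((N : ℝ) / 2 - ((N : ℝ) * |β| * Λ₀ + η) - (max (6 * ((d : ℝ) - 1) * N * |β|) 0 * (Real.exp κ - 1) + Θ)) :=
  beDoorQL_gibbsCov_le_of_strip hH hN β hL s hE hr hM hSB (c2PolyApprox_of_contDiff (contDiff_finset_sum s hE)) hη D hD hκ
    hΘ hK hu hv hδu hδv hLu hLv hDv hDu

/-- ★★★ **THE TYPED BRIDGE FROM FORMAT DATA ALONE, NO OTHER HYPOTHESIS** — `beDoorQL_gibbsCov_le_of_format` without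
`C2PolyApprox`: format data `(X i, M i, r, δ i)`, the loads `η`, `Θ`, and the door inequality ⇒ volume-uniform exponential
clustering of `gibbsCov (wilsonPot β + Σ E i)`. [folklore assembly] [folklore] -/
theorem beDoorQL_gibbsCov_le_of_format' {Λ₀ : ℝ} (hH : WilsonHessianBound d N Λ₀) (hN : N ≠ 0) (β : ℝ) (hL : 1 < L)
    {K : Type*} (s : Finset K) {E : K → Cfg (Edge d L) N → ℝ} (hE : ∀ i, ContDiff ℝ ∞ (E i))
    {X : K → Finset (Edge d L)} {M : K → ℝ} {r : ℝ} (hr : 0 < r) (hM : ∀ i ∈ s, 0 ≤ M i)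
    (hSB : ∀ i ∈ s, StripBoundOn (E i) (X i) (M i) r)
    {η : ℝ} (hη : ∀ e, hessLoad s X (fun i => 2 * M i / r ^ 2) e ≤ η)
    (D : Edge d L → ℕ) (hD : ∀ e e', e' ∈ linkNbrT e → D e ≤ D e' + 1) {κ Θ : ℝ} (hκ : 0 ≤ κ) {δ : K → ℝ}
    (hδ : ∀ i ∈ s, ∀ e ∈ X i, ∀ e' ∈ X i, |(D e : ℝ) - D e'| ≤ δ i)
    (hΘ : ∀ e, ∑ i ∈ s, (if e ∈ X i then 4 * M i / r ^ 2 * (X i).card * (Real.exp (κ * δ i) - 1) else 0) ≤ Θ)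
    (hK : 0 < (N : ℝ) / 2 - ((N : ℝ) * |β| * Λ₀ + η) -
      (max (6 * ((d : ℝ) - 1) * N * |β|) 0 * (Real.exp κ - 1) + Θ))
    {u v : Cfg (Edge d L) N → ℝ} (hu : ContDiff ℝ ∞ u) (hv : ContDiff ℝ ∞ v)
    {δu δv : Edge d L → ℝ} (hδu : ∀ e, 0 ≤ δu e) (hδv : ∀ e, 0 ≤ δv e)
    (hLu : LinkLipschitz u δu) (hLv : LinkLipschitz v δv)
    (hDv : ∀ e, δv e ≠ 0 → D e = 0) {m : ℕ} (hDu : ∀ e, δu e ≠ 0 → m ≤ D e) :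
    |gibbsCov (wilsonPot d N L β + ∑ i ∈ s, E i) u v| ≤
      Real.exp (-κ * m) * (∑ e, δu e) * (∑ e, δv e) /
        ((N : ℝ) / 2 - ((N : ℝ) * |β| * Λ₀ + η) - (max (6 * ((d : ℝ) - 1) * N * |β|) 0 * (Real.exp κ - 1) + Θ)) :=
  beDoorQL_gibbsCov_le_of_format hH hN β hL s hE hr hM hSB (c2PolyApprox_of_contDiff (contDiff_finset_sum s hE)) hη D hD hκ
    hδ hΘ hK hu hv hδu hδv hLu hLv hDv hDu

/-- ★★★ **THE RECEIVER ON THE MEMBER'S OWN MEASURE, FORMAT DATA ALONE** — `perturbedMeasure_cov_le_of_format` without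
`C2PolyApprox`: for every block scale `b`, every member `W` whose total action is (minus) a finite sum of smooth strip-format terms,
and every torus side `L ≥ 2`, the covariance of smooth link-Lipschitz ambient observables `m` apart in `D` under
`W.perturbedMeasure (fundamentalRep) (Nβ)` is `≤ K⁻¹ e^{−κ m} (Σδu)(Σδv)` whenever the door `K > 0` is open. [folklore assembly] [folklore] -/
theorem perturbedMeasure_cov_le_of_format' {Λ₀ : ℝ} (hH : WilsonHessianBound d N Λ₀) (hN : N ≠ 0) (β : ℝ) (hL : 1 < L)
    {b : ℕ} (W : QuasiLocalGaugePerturbation d L (SUN N) b)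
    {K : Type*} (s : Finset K) {E : K → Cfg (Edge d L) N → ℝ} (hE : ∀ i, ContDiff ℝ ∞ (E i))
    (hW : ∀ U : PSU (Edge d L) N, (∑ i ∈ s, E i) (emb U) = -W.total U)
    {X : K → Finset (Edge d L)} {M : K → ℝ} {r : ℝ} (hr : 0 < r) (hM : ∀ i ∈ s, 0 ≤ M i)
    (hSB : ∀ i ∈ s, StripBoundOn (E i) (X i) (M i) r)
    {η : ℝ} (hη : ∀ e, hessLoad s X (fun i => 2 * M i / r ^ 2) e ≤ η)
    (D : Edge d L → ℕ) (hD : ∀ e e', e' ∈ linkNbrT e → D e ≤ D e' + 1) {κ Θ : ℝ} (hκ : 0 ≤ κ) {δ : K → ℝ}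
    (hδ : ∀ i ∈ s, ∀ e ∈ X i, ∀ e' ∈ X i, |(D e : ℝ) - D e'| ≤ δ i)
    (hΘ : ∀ e, ∑ i ∈ s, (if e ∈ X i then 4 * M i / r ^ 2 * (X i).card * (Real.exp (κ * δ i) - 1) else 0) ≤ Θ)
    (hK : 0 < (N : ℝ) / 2 - ((N : ℝ) * |β| * Λ₀ + η) -
      (max (6 * ((d : ℝ) - 1) * N * |β|) 0 * (Real.exp κ - 1) + Θ))
    {u v : Cfg (Edge d L) N → ℝ} (hu : ContDiff ℝ ∞ u) (hv : ContDiff ℝ ∞ v)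
    {δu δv : Edge d L → ℝ} (hδu : ∀ e, 0 ≤ δu e) (hδv : ∀ e, 0 ≤ δv e)
    (hLu : LinkLipschitz u δu) (hLv : LinkLipschitz v δv)
    (hDv : ∀ e, δv e ≠ 0 → D e = 0) {m : ℕ} (hDu : ∀ e, δu e ≠ 0 → m ≤ D e) :
    |cov[fun U => u (emb U), fun U => v (emb U); W.perturbedMeasure (fundamentalRep (Fin N)) ((N : ℝ) * β)]| ≤
      Real.exp (-κ * m) * (∑ e, δu e) * (∑ e, δv e) /
        ((N : ℝ) / 2 - ((N : ℝ) * |β| * Λ₀ + η) - (max (6 * ((d : ℝ) - 1) * N * |β|) 0 * (Real.exp κ - 1) + Θ)) :=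
  perturbedMeasure_cov_le_of_format hH hN β hL W s hE hW hr hM hSB (c2PolyApprox_of_contDiff (contDiff_finset_sum s hE)) hη D
    hD hκ hδ hΘ hK hu hv hδu hδv hLu hLv hDv hDu

end Unconditional

/-! ## §8 (v7).  OUTPUT in `RobustBall.ClustersWith` — like-for-like with P2's Dobrushin door

`RobustBall.ClustersWith W β A m` (the input predicate of P2's `YMBeyond.P2.Y2.yangMills_of_legs`, of `ClusteringLeg`, of
`RobustYangMills`) quantifies over measurable bounded observables `f, g : SU(N)^{E(Λ_L)} → ℝ` with coordinatewise
`suFrobDist`-Lipschitz data `IsLipBound suFrobDist f δf` depending on `Δf`, `Δg` at torus distance `≥ n`.  The Bakry–Émery door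
(§7 `perturbedMeasure_cov_le_of_format'`) speaks of smooth ambient observables with `LinkLipschitz` data and an abstract
distance function `D`.  §8a closes the first gap (McShane extension `mcShane` + mollification by a normed bump keep the per-link
data: `exists_contDiff_linkLipschitz_approx`), §8b the second (the distance function to the support of `δv`, as in the tree's
`SharpClustering.torus_covariance_exp_decay`, whose oscillation on a term's link set is at most its torus diameter), §8c assembles:
`clustersWith_of_format` — format data + open door ⇒ `ClustersWith W (Nβ) K⁻¹ κ` on the nose. -/

section AbstractSmoothing

open scoped Convolution NNReal

variable {ι : Type*} [Fintype ι] {V : Type*} [NormedAddCommGroup V] [NormedSpace ℝ V] [FiniteDimensional ℝ V]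

/-- Per-coordinate moduli, summed: `|F x − F y| ≤ Σ_e δ_e ‖x_e − y_e‖` on a finite product of normed spaces. [folklore] -/
@[folklore]
def SumLip (F : (ι → V) → ℝ) (δ : ι → ℝ) : Prop :=
  ∀ x y : ι → V, |F x - F y| ≤ ∑ e, δ e * ‖x e - y e‖

omit [NormedSpace ℝ V] [FiniteDimensional ℝ V] in
/-- Summed per-coordinate moduli give the global Lipschitz constant `Σ_e δ_e` for the sup norm. [folklore] -/
theorem SumLip.lipschitzWith {F : (ι → V) → ℝ} {δ : ι → ℝ} (hδ : ∀ e, 0 ≤ δ e) (hF : SumLip F δ) :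
    LipschitzWith ⟨∑ e, δ e, sum_nonneg fun e _ => hδ e⟩ F := by
  refine LipschitzWith.of_dist_le_mul fun x y => ?_
  rw [Real.dist_eq, dist_eq_norm]
  refine (hF x y).trans ?_
  change ∑ e, δ e * ‖x e - y e‖ ≤ (∑ e, δ e) * ‖x - y‖
  rw [Finset.sum_mul]
  exact Finset.sum_le_sum fun e _ => mul_le_mul_of_nonneg_left (by simpa using norm_le_pi_norm (x - y) e) (hδ e)

/-- **Mollification keeps the summed per-coordinate moduli**: convolution of `F` with a normed bump (nonnegative, mass
one) satisfies the same bound `|G x − G y| ≤ Σ_e δ_e ‖x_e − y_e‖`. [folklore] -/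
theorem sumLip_normed_convolution [MeasurableSpace (ι → V)] [BorelSpace (ι → V)] {μ : Measure (ι → V)}
    [μ.IsAddHaarMeasure] (φ : ContDiffBump (0 : ι → V)) {F : (ι → V) → ℝ} {δ : ι → ℝ} (hδ : ∀ e, 0 ≤ δ e)
    (hF : SumLip F δ) : SumLip (φ.normed μ ⋆[ContinuousLinearMap.lsmul ℝ ℝ, μ] F) δ := by
  intro x y
  have hφc : Continuous (φ.normed μ) := φ.continuous_normed
  have hφs : HasCompactSupport (φ.normed μ) := φ.hasCompactSupport_normed
  have hfc : Continuous F := (hF.lipschitzWith hδ).continuous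
  have hint : ∀ z : ι → V, Integrable (fun t => φ.normed μ t * F (z - t)) μ := fun z =>
    (hφc.mul (hfc.comp (continuous_const.sub continuous_id))).integrable_of_hasCompactSupport
      (hφs.mul_right)
  have hconv : ∀ z : ι → V, (φ.normed μ ⋆[ContinuousLinearMap.lsmul ℝ ℝ, μ] F) z =
      ∫ t, φ.normed μ t * F (z - t) ∂μ := fun z => by
    rw [convolution_def]; rfl
  rw [hconv, hconv, ← integral_sub (hint x) (hint y)]
  have hbound : ∀ t, ‖φ.normed μ t * F (x - t) - φ.normed μ t * F (y - t)‖ ≤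
      φ.normed μ t * ∑ e, δ e * ‖x e - y e‖ := fun t => by
    rw [← mul_sub, norm_mul, Real.norm_of_nonneg (φ.nonneg_normed t)]
    refine mul_le_mul_of_nonneg_left ?_ (φ.nonneg_normed t)
    have h := hF (x - t) (y - t)
    rw [Real.norm_eq_abs]
    refine h.trans (le_of_eq (Finset.sum_congr rfl fun e _ => ?_))
    rw [Pi.sub_apply, Pi.sub_apply, sub_sub_sub_cancel_right]
  have h := norm_integral_le_of_norm_le ((φ.integrable_normed (μ := μ)).mul_const _) (ae_of_all _ hbound)
  rw [integral_mul_const, φ.integral_normed, one_mul, Real.norm_eq_abs] at h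
  exact h

/-- **Smooth approximation keeping the summed per-coordinate moduli**: `F` with moduli `δ ≥ 0` is, for every `ε > 0`,
uniformly `(Σδ)ε`-close to a `C^∞` function with the same moduli (`φ_ε ⋆ F`, `φ_ε` a normed bump in the `ε`-ball;
Mathlib `ContDiffBump.normed`, `HasCompactSupport.contDiff_convolution_left`, `ContDiffBump.dist_normed_convolution_le`). [folklore] -/
theorem exists_contDiff_sumLip_approx {F : (ι → V) → ℝ} {δ : ι → ℝ} (hδ : ∀ e, 0 ≤ δ e) (hF : SumLip F δ)
    {ε : ℝ} (hε : 0 < ε) :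
    ∃ G : (ι → V) → ℝ, ContDiff ℝ ∞ G ∧ SumLip G δ ∧ ∀ x, |G x - F x| ≤ (∑ e, δ e) * ε := by
  borelize (ι → V)
  set φ : ContDiffBump (0 : ι → V) := ⟨ε / 2, ε, half_pos hε, half_lt_self hε⟩
  have hlip := hF.lipschitzWith hδ
  refine ⟨φ.normed Measure.addHaar ⋆[ContinuousLinearMap.lsmul ℝ ℝ, Measure.addHaar] F, ?_, ?_, ?_⟩
  · exact φ.hasCompactSupport_normed.contDiff_convolution_left _ φ.contDiff_normed
      (hlip.continuous.locallyIntegrable (μ := Measure.addHaar))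
  · exact sumLip_normed_convolution φ hδ hF
  · intro a
    rw [← Real.dist_eq]
    refine φ.dist_normed_convolution_le hlip.continuous.aestronglyMeasurable fun x hx => ?_
    refine (hlip.dist_le_mul x a).trans ?_
    exact mul_le_mul_of_nonneg_left (le_of_lt (Metric.mem_ball.1 hx)) (sum_nonneg fun e _ => hδ e)

end AbstractSmoothing

section SmoothingLip

open Literature.Probability.LatticeModels.DobrushinMetric (IsLipBound abs_sub_le_sum_of_dependsOn)

variable {ι : Type u} [Fintype ι] [DecidableEq ι] {N : ℕ}

/-- The McShane–Whitney extension of `f : SU(N)^ι → ℝ` with per-link moduli `δ` to the ambient space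
`(ι → M_N(ℂ))`: `Q ↦ inf_U (f U + Σ_e δ_e ‖Q_e − U_e‖_F)`. [folklore] -/
def mcShane (f : PSU ι N → ℝ) (δ : ι → ℝ) (Q : Cfg ι N) : ℝ :=
  ⨅ U : PSU ι N, (f U + ∑ e, δ e * ‖Q e - (U e : Matrix (Fin N) (Fin N) ℂ)‖)

omit [DecidableEq ι] in
/-- The McShane family `U ↦ f U + Σ_e δ_e ‖Q_e − U_e‖` of a bounded `f` with non-negative moduli is bounded below. [folklore] -/
theorem mcShane_bddBelow {f : PSU ι N → ℝ} (hf : ∃ M, ∀ U, |f U| ≤ M) {δ : ι → ℝ} (hδ : ∀ e, 0 ≤ δ e)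
    (Q : Cfg ι N) :
    BddBelow (Set.range fun U : PSU ι N => f U + ∑ e, δ e * ‖Q e - (U e : Matrix (Fin N) (Fin N) ℂ)‖) := by
  obtain ⟨M, hM⟩ := hf
  refine ⟨-M, ?_⟩
  rintro _ ⟨U, rfl⟩
  have h1 : -M ≤ f U := (abs_le.1 (hM U)).1
  have h2 : 0 ≤ ∑ e, δ e * ‖Q e - (U e : Matrix (Fin N) (Fin N) ℂ)‖ :=
    sum_nonneg fun e _ => mul_nonneg (hδ e) (norm_nonneg _)
  linarith

omit [DecidableEq ι] in
/-- The McShane extension has the summed per-link moduli `δ`. [folklore] -/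
theorem sumLip_mcShane {f : PSU ι N → ℝ} (hf : ∃ M, ∀ U, |f U| ≤ M) {δ : ι → ℝ} (hδ : ∀ e, 0 ≤ δ e) :
    SumLip (mcShane f δ) δ := by
  intro x y
  set c : ℝ := ∑ e, δ e * ‖x e - y e‖ with hc
  have key : ∀ U : PSU ι N,
      |(f U + ∑ e, δ e * ‖x e - (U e : Matrix (Fin N) (Fin N) ℂ)‖) -
        (f U + ∑ e, δ e * ‖y e - (U e : Matrix (Fin N) (Fin N) ℂ)‖)| ≤ c := by
    intro U
    rw [add_sub_add_left_eq_sub, ← Finset.sum_sub_distrib]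
    refine (Finset.abs_sum_le_sum_abs _ _).trans (Finset.sum_le_sum fun e _ => ?_)
    rw [← mul_sub, abs_mul, abs_of_nonneg (hδ e)]
    refine mul_le_mul_of_nonneg_left ?_ (hδ e)
    have h := abs_norm_sub_norm_le (x e - (U e : Matrix (Fin N) (Fin N) ℂ)) (y e - (U e : Matrix (Fin N) (Fin N) ℂ))
    rwa [sub_sub_sub_cancel_right] at h
  have hx := mcShane_bddBelow hf hδ x
  have hy := mcShane_bddBelow hf hδ y
  rw [abs_le]
  constructor
  · -- `mcShane y ≤ mcShane x + c`
    have h : mcShane f δ y - c ≤ mcShane f δ x := by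
      refine le_ciInf fun U => ?_
      have h1 : mcShane f δ y ≤ f U + ∑ e, δ e * ‖y e - (U e : Matrix (Fin N) (Fin N) ℂ)‖ := ciInf_le hy U
      have h2 := (abs_le.1 (key U)).1
      linarith
    linarith
  · have h : mcShane f δ x - c ≤ mcShane f δ y := by
      refine le_ciInf fun U => ?_
      have h1 : mcShane f δ x ≤ f U + ∑ e, δ e * ‖x e - (U e : Matrix (Fin N) (Fin N) ℂ)‖ := ciInf_le hx U
      have h2 := (abs_le.1 (key U)).2
      linarith
    linarith

/-- The McShane extension restricts to `f` on `SU(N)^ι` when `δ` bounds the coordinatewise `suFrobDist`-Lipschitz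
constants of `f` (Föllmer's interpolation bound `|f σ − f τ| ≤ Σ_e δ_e ‖σ_e − τ_e‖_F`). [folklore] -/
theorem mcShane_emb {f : PSU ι N → ℝ} (hf : ∃ M, ∀ U, |f U| ≤ M) {δ : ι → ℝ} (hδ : IsLipBound suFrobDist f δ)
    (U₀ : PSU ι N) : mcShane f δ (emb U₀) = f U₀ := by
  have hB := mcShane_bddBelow hf hδ.nonneg (emb U₀)
  refine le_antisymm ?_ ?_
  · refine (ciInf_le hB U₀).trans (le_of_eq ?_)
    simp
  · refine le_ciInf fun U => ?_
    have hdep : DependsOn f (↑(Finset.univ : Finset ι) : Set ι) := fun _ _ h =>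
      congrArg f (funext fun i => h i (by simp))
    have h := abs_sub_le_sum_of_dependsOn hdep hδ U₀ U
    have h' : ∀ e, suFrobDist (U₀ e) (U e) = ‖emb U₀ e - (U e : Matrix (Fin N) (Fin N) ℂ)‖ := fun e => by
      rw [suFrobDist, frobNorm_eq_norm, emb_apply]
    simp_rw [h'] at h
    linarith [(abs_le.1 h).2]

/-- ★ **Lipschitz → smooth on `SU(N)^ι`, keeping the per-link data**: a bounded `f : SU(N)^ι → ℝ` with coordinatewise
`suFrobDist`-Lipschitz bounds `δ` (`IsLipBound`, the currency of `RobustBall.ClustersWith`) is, for every `ε > 0`, uniformly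
`ε`-close on `SU(N)^ι` to the restriction of a `C^∞` ambient function `u` with `LinkLipschitz u δ` (the currency of the
tree's Bakry–Émery door).  McShane extension + mollification. [folklore] -/
theorem exists_contDiff_linkLipschitz_approx {f : PSU ι N → ℝ} (hf : ∃ M, ∀ U, |f U| ≤ M) {δ : ι → ℝ}
    (hδ : IsLipBound suFrobDist f δ) {ε : ℝ} (hε : 0 < ε) :
    ∃ u : Cfg ι N → ℝ, ContDiff ℝ ∞ u ∧ LinkLipschitz u δ ∧ ∀ U, |u (emb U) - f U| ≤ ε := by
  have hS : 0 ≤ ∑ e, δ e := sum_nonneg fun e _ => hδ.nonneg e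
  have hε' : 0 < ε / (∑ e, δ e + 1) := div_pos hε (by linarith)
  obtain ⟨G, hG, hGL, hGF⟩ := exists_contDiff_sumLip_approx hδ.nonneg (sumLip_mcShane hf hδ.nonneg) hε'
  refine ⟨G, hG, fun e g h hgh => ?_, fun U => ?_⟩
  · have h1 := hGL (emb g) (emb h)
    rw [Finset.sum_eq_single e (fun e' _ he' => by rw [emb_apply, emb_apply, hgh e' he', sub_self, norm_zero, mul_zero])
      (fun he => absurd (Finset.mem_univ e) he)] at h1
    rwa [suFrobDist, frobNorm_eq_norm, ← emb_apply g e, ← emb_apply h e]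
  · have h1 := hGF (emb U)
    rw [mcShane_emb hf hδ U] at h1
    refine h1.trans ?_
    calc (∑ e, δ e) * (ε / (∑ e, δ e + 1)) = ε * ((∑ e, δ e) / (∑ e, δ e + 1)) := by ring
      _ ≤ ε * 1 := mul_le_mul_of_nonneg_left (div_le_one_of_le₀ (by linarith) (by linarith)) hε.le
      _ = ε := mul_one ε

end SmoothingLip

end Summit.Ventures.YMGap.BEDoor
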